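import Mathlib
import HarnessLib
import Summits.Langlands.Statement
import Summits.Langlands.Langlands.Theses.KroneckerPrimitivitySplit
import Summits.Langlands.Langlands.Theorems.MonodromyDichotomyKroneckerPrimitivity

set_option linter.dupNamespace false

/-!
# MonodromyDichotomyCartanRank — statement-and-kernel support module (tree twin of the decomp-langlands lens-2 gen-13 node `CartanRankSplit`; `--supports stmt-Langlands-27370`)

(Landed by census-1 g17 from `HOME/nodes/lens-2-g13-CartanRankSplit.MonodromyDichotomyCartanRank.lean` sha256 cb13626f56d4…, 318 lines, verbatim + five one-line docstrings (three `…_iff`, two `…_of_langlands`); statements byte-identical.)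

The node header follows verbatim.  CartanRankSplit — decomp-langlands lens-2 gen 13 (structural dichotomy «special vs generic», RESIDUAL MODE, BLOCKER FIRST)

TARGET (a LAYER-2 DECLARED RESIDUAL of the cell, by name): PRIM = `KroneckerPrimitivitySplit.SolvablyTensorPrimitiveAutomorphy`
(stmt-Langlands-27370, crux rank 4, OPEN, the declared residual of route-Langlands-KroneckerPrimitivitySplit rev 0 @4119912572a4 —
the child route born 2026-08-30 L830 from NODE lens-2-g12 under H = `MonodromyDichotomy.HigherLieRankAutomorphy` stmt-Langlands-31222 of
route-Langlands-MonodromyDichotomy rev 3).  PRIM = clause (B) in rank-induction form for the irreducible pinned-geometric LIE-IRREDUCIBLE ρ of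
rank n ≥ 3 WITHOUT progression spectra near 1 that are SOLVABLY TENSOR-PRIMITIVE (over no solvable Galois E/K is ρ|_E an E-rational
Kronecker product of two Lie factors): on paper, the (B)-instances whose derived connected monodromy group (G°)^der is SIMPLE (modulo centre,
modulo Tate–Patrikis lifting) and not a principal SL₂.

THESIS (lens 2 = special STRUCTURE vs GENERIC = big image, read on the Lie TYPE of the simple group H = (G°)^der ⊂ SL_n through two
invariants of the CHARACTERISTIC POLYNOMIALS, both invariant under EVERY finite restriction and under twisting by characters):
 (I) the CARTAN RANK r = rank H, typed as «in every neighbourhood of 1 some g has r multiplicatively independent eigenvalue RATIOS»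
     (`HasRatioRankAtLeast ρ r`; Larsen–Pink, Invent. Math. 107 (1992): the formal character of G° is read off the characteristic polynomials on
     a dense open set; ratios kill the centre), cut at the threshold r ≥ ⌊n/2⌋ (= `n / 2`);
 (II) the ACCIDENTAL WINDOW so₆ ≅ sl₄ (D₃ = A₃): «ρ is, over a solvable Galois E/K, a character twist of the EXTERIOR SQUARE of a rank-4 Lie
     factor σ» (`IsSolvablyExteriorSquare ρ`: roots(charpoly ρ|_E(g)) = χ(g)·{pairwise products of roots(charpoly σ(g))}, n = 6).
CLASSIFICATION LEMMA (Lie theory, memo §3; Lübeck 2001 / Kleidman–Liebeck §5.4 tables of small modules): a faithful irreducible module V of a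
connected semisimple H with dim V ≤ 2·rank H + 1 is the STANDARD module of SL_n, Sp_n or SO_n (the accidents B₂ = C₂ (SO₅), D₃ = A₃ (SO₆ = ∧² of
SL₄), D₄-triality (SO₈) and A₁ = B₁ (SO₃ = Sym², principal) ARE standard orthogonal modules) or a Kronecker box (2,b), (3,3) — which PRIM excludes.
Hence, inside PRIM:  LARGE (r ≥ ⌊n/2⌋) = STANDARD CLASSICAL TYPE = transport-TERMINAL (no lower-rank structure exists: every functorial transport
GL_{<n} → GL_n is exhausted; only automorphy-LIFTING methods can enter), and SMALL (r < ⌊n/2⌋) = a NON-standard module of a LOWER-rank group =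
exactly ONE named OPEN functoriality each (Sym^k / ∧^k of GL_m with m ≥ 3 / m ≥ 5, spin of GSpin_{2r+1} (r ≥ 3), G₂ → GL₇, F₄ → GL₂₆, E₆ → GL₂₇,
E₇ → GL₅₆ …, after the rank-IH / reciprocity for the smaller group).  The ONE print engine left on PRIM sits at the accidental window: there clause
(B) IS Kim's exterior-square functoriality GL₄ → GL₆ (tree fact `Kim2003_exteriorSquare_GL4`, archimedean clause
`Kim2003_exteriorSquare_GL4_archimedean` with `….exists_lift_isLAlgebraic`, cuspidality criterion `AsgariRaghuram…ExteriorSquareCuspidal`,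
automorphic-side floor `Cruxes.ReciprocityUpToIrreducibility.ExteriorSquareGL5GaloisToAutomorphic.floor_four`) given the rank-IH at m = 4.

    PRIM ⟸ ACC `AccidentalWindowTransport` [NEW · crux 2 · WEAKER · ATTACKABLE-NOW / CLOSABLE MOD PRINT: K-rationally exterior-square ρ (n = 6):
              rank-IH automorphy of σ on GL₄ + Kim 2003 Thm A (∧²: GL₄ → GL₆, every cuspidal π, every K) + cuspidality of ∧²π₄ from the SO₆-type of
              ρ (Asgari–Raghuram criterion: the exceptional types — self-twist, symplectic/orthogonal pole, Sym³ — are excluded σ-side by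
              Lie-irreducibility / no invariant line in the irreducible rank-6 ∧²σ / no progression) + L-algebraicity of ∧²π₄ (Kim's archimedean
              clause, tree theorem `exists_lift_isLAlgebraic`) + the twist by the geometric character χ (CFT: algebraic Hecke character); NO descent,
              NO lifting: σ and χ are given over K itself]
      ∧  SMALL `SmallTypeTransport` [NEW · crux 3 · WEAKER · IDEA-NEEDED (residual conjunct): Cartan rank < ⌊n/2⌋ = non-standard module of a lower-rank
              group: clause (B) = the named OPEN functorialities above; no print engine on any sub-box (∧² GL₄ is LARGE, Sym^k GL₂ is excluded by
              «no progression»); `TwistedEndoscopySelfDual` head-on for the non-self-dual ones, beyond-endoscopy otherwise; UNDECIDED]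
      ∧  STD `StandardTypeAutomorphy` [NEW · crux 4 · WEAKER · NEW DECLARED RESIDUAL · UNDECIDED / BARRIER-PLACED: Cartan rank ≥ ⌊n/2⌋ and NOT solvably
              an exterior square = (G°)^der ∈ {SL_n (n ≥ 3), Sp_n (n ≥ 4), SO_n (n ≥ 5, n ≠ 6)} in its standard module (+ the Tate–Patrikis-empty set
              of SO₆-types without solvable spin lift): the GENERIC bulk where NO transport applies by construction; print engines = automorphy
              lifting (BLGGT / 10-author) needing residual automorphy + regularity + CM/TR (`ResiduallyReducibleBarrier`, `NonRegularWeightBarrier`,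
              `ShimuraVarietyRealizationBarrier(Narrow)` placed); instrumentable sub-box named, not carved: SO₅-type (B₂ = C₂: ρ ⊕ ν ≅ ∧²σ, σ of
              GSp₄-type — Kim's ∧² + a GL₁-peel by Ginzburg–Rallis–Soudry descent, L-sized fine print)]
      ∧  CSD `KroneckerPrimitivitySplit.CliffordSolvableDescent` [DEDUP-ATTACH stmt-Langlands-31695 (support, PRINT mod W⁺) — the ONE solvable
              descent, in the kernel, on the window]
      ∧  W⁺ `KroneckerPrimitivitySplit.SatakeAvatarExistence` [DEDUP-ATTACH stmt-Langlands-17415 (crux, OPEN, N0 core)]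
      ∧  FRAME `TensorPrimitiveFrame := PRIM → Langlands` [support · imported complement = the HOST ROUTE KroneckerPrimitivitySplit below PRIM
              (KT_low 27368, KT_high 27369, CSD, W⁺, FRAME_H 27371) through its certified `KroneckerPrimitivitySplit.closes` (`frame_of_host`), and
              further down route-Langlands-MonodromyDichotomy rev 3 (`frame_of_grandhost`)]

EXACTNESS: PRIM ⟹ ACC ∧ SMALL ∧ STD outright (`cells_of_prim`: every cell is PRIM with ONE inserted hypothesis); ACC → SMALL → STD → PRIM modulo
(W⁺ ∧ CSD) (`prim_of_cells`: excluded middle on the SOLVABLE exterior-square dial — on the window ACC is run over the witness field E on ρ|_E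
(the rank-IH is field-universal; the E-level PRIM-box clauses sit INSIDE the dial, paper-equal by heredity + the Galois-closure remark) and the
weak automorphy is descended E → K by CSD fed with W⁺ (ϑ := ρ|_E, rank-0 complement) — then excluded middle on the CARTAN RANK over K itself
(no descent: the rank is restriction-invariant)).  Langlands ⟺ (ACC ∧ SMALL ∧ STD) ∧ CSD ∧ W⁺ ∧ FRAME (`langlands_iff_pieces`, EXACT mod NOTHING).
COSTUME census: 0 EQUIV pieces (probes: no cell, no cell-with-its-inserted-hypothesis-dropped… see `.probes.lean`); every NEW piece WEAKER
(`…_of_langlands`); CSD/W⁺/FRAME are host items by name.  ORBIT CLOSURE (rows 6/48/156): both dials are invariant under restriction to ANY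
finite extension (Cartan rank and Lie type do not see finite index) and under ⊗χ (ratios; χ absorbed), and the window dial is SATURATED over
solvable Galois E ⊇ (descent done once by CSD): no kernel-closable instance is booked in STD or SMALL.
WHY NOVEL (cell-relative): no node or route of record reads the RANK of the monodromy Lie algebra or an exceptional isomorphism of Lie types:
LieRankDichotomy (g3) is «semisimple rank 1 (principal SL₂) vs ≥ 2», KroneckerPrimitivitySplit (g12) is simplicity/⊗-decomposability, lens-4's
Kronecker/base-change dials live on the companion box, PolarisationCarving is duality, WeightMultiplicitySplit is Hodge–Tate multiplicity; the
in-tree ∧²-ladder `ExteriorSquareGaloisToAutomorphic m` (fwd G4, Cruxes/ReciprocityUpToIrreducibility) dials the SOURCE rank of ∧² on the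
AUTOMORPHIC side (ρ ≅ ∧²ρ_π presupposing π) — here the Galois-side solvable ∧²-type is a dial on the RESIDUAL PRIM, its floor m = 4 is the closable
cell, and the classification lemma converts «Cartan rank ≥ ⌊n/2⌋» into the statement that functorial slicing of PRIM is EXHAUSTED at STD.
-/


namespace Summit.Langlands.Langlands.Theorems.MonodromyDichotomyCartanRank

open Summit.Langlands.Langlands.Theses

open scoped BigOperators Classical Matrix
open Summit.Langlands.Langlands.Theorems.MonodromyDichotomyKroneckerPrimitivity (PinnedGeometric IsLieIrreducible HasProgressionSpectra InHigherLieRankBox IsLieFactor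
  IsRationalKronecker IsSolvablyKronecker WeakAutomorphic RankIH trace_restrictField_eq_add_zero)

/-! ## 1. Vocabulary (structured forms; the items in §4 inline them VERBATIM — `Iff.rfl` bridges in §5).  The H-box vocabulary
(`PinnedGeometric`, `IsLieIrreducible`, `HasProgressionSpectra`, `InHigherLieRankBox`, `IsLieFactor`, `IsSolvablyKronecker`, `WeakAutomorphic`,
`RankIH`) is the LANDED twin module `Theorems.MonodromyDichotomyKroneckerPrimitivity` (p779554), opened by name. -/
section Vocabulary
variable {K : Type} [Field K] [NumberField K] {ℓ : ℕ} [Fact ℓ.Prime] {n : ℕ}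

/-- the PRIM-BOX over K: the H-box (irreducible ∧ pinned-geometric ∧ Lie-irreducible ∧ no progression spectra) AND not solvably Kronecker —
exactly PRIM's hypotheses on ρ. -/
def InTensorPrimitiveBox (ρ : Literature.NumberTheory.GaloisRepresentations.FramedGaloisRep K (PadicAlgCl ℓ) n) : Prop :=
  InHigherLieRankBox ρ ∧ ¬ IsSolvablyKronecker ρ

/-- DIAL (I) — CARTAN RANK ≥ k: in every open neighbourhood of 1 in Γ_K there is g whose characteristic polynomial splits with roots e₀,…,e_{n-1}
admitting k MULTIPLICATIVELY INDEPENDENT RATIOS e_i/e_j.  On paper (Larsen–Pink 1992; generic elements of the ℓ-adic Lie group are dense):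
⟺ rank (G°)^der ≥ k, G the Zariski closure of ρ(Γ_K); invariant under every finite restriction and under ⊗χ. -/
def HasRatioRankAtLeast (ρ : Literature.NumberTheory.GaloisRepresentations.FramedGaloisRep K (PadicAlgCl ℓ) n) (k : ℕ) : Prop :=
  (∀ U : Set (Field.absoluteGaloisGroup K), IsOpen U → (1 : Field.absoluteGaloisGroup K) ∈ U → ∃ g ∈ U, ∃ e : Fin n → PadicAlgCl ℓ, (Literature.NumberTheory.GaloisRepresentations.FramedRep.charpoly ρ g).roots = (Finset.univ : Finset (Fin n)).val.map e ∧ ∃ ij : Fin k → Fin n × Fin n, ∀ a : Fin k → ℤ, (∏ t : Fin k, (e (ij t).1 / e (ij t).2) ^ (a t)) = 1 → a = 0)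

/-- DIAL (II) over K itself — K-RATIONALLY AN EXTERIOR SQUARE (the accidental window D₃ = A₃): n = 6 and for a rank-4 LIE FACTOR σ and a
pinned-geometric character χ over K, roots(charpoly ρ(g)) = χ(g) · {e_i e_j : i < j} ({e_i} = roots(charpoly σ(g))) for all g ∈ Γ_K — by
Brauer–Nesbitt ρ ≅ ∧²σ ⊗ χ. -/
def IsRationalExteriorSquare (ρ : Literature.NumberTheory.GaloisRepresentations.FramedGaloisRep K (PadicAlgCl ℓ) n) : Prop :=
  (n = 6 ∧ ∃ (σ : Literature.NumberTheory.GaloisRepresentations.FramedGaloisRep K (PadicAlgCl ℓ) 4) (χ : Literature.NumberTheory.GaloisRepresentations.FramedGaloisRep K (PadicAlgCl ℓ) 1), (σ.toGaloisRep.IsIrreducible ∧ ((∀ᶠ v : IsDedekindDomain.HeightOneSpectrum (NumberField.RingOfIntegers K) in Filter.cofinite, σ.IsUnramifiedAt v) ∧ ∀ (v : IsDedekindDomain.HeightOneSpectrum (NumberField.RingOfIntegers K)) (hv : ((ℓ : ℕ) : NumberField.RingOfIntegers K) ∈ v.asIdeal), (Literature.NumberTheory.PAdicHodge.fontainePstAdicCompletion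 v ℓ hv).IsDeRhamFramed (σ.toLocal v)) ∧ (∀ (L : Type) [Field L] [NumberField L] [Algebra K L], (σ.restrictField L).toGaloisRep.IsIrreducible)) ∧ ((∀ᶠ v : IsDedekindDomain.HeightOneSpectrum (NumberField.RingOfIntegers K) in Filter.cofinite, χ.IsUnramifiedAt v) ∧ ∀ (v : IsDedekindDomain.HeightOneSpectrum (NumberField.RingOfIntegers K)) (hv : ((ℓ : ℕ) : NumberField.RingOfIntegers K) ∈ v.asIdeal), (Literature.NumberTheory.PAdicHodge.fontainePstAdicCompletion v ℓ hv).IsDeRhamFramed (χ.toLocal v)) ∧ ∀ g : Field.absoluteGaloisGroup K, (Literature.NumberTheory.GaloisRepresentations.FramedRep.charpoly ρ g).roots = (((Literature.NumberTheory.GaloisRepresentations.FramedRep.charpoly σ g).roots.powersetCard 2).map Multiset.prod).map (fun x => Literature.NumberTheory.GaloisRepresentations.FramedRep.trace χ g * x))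

/-- THE SATURATED WINDOW DIAL — SOLVABLY AN EXTERIOR SQUARE: over some solvable Galois E/K, ρ|_E is (still in the PRIM-box over E and)
E-rationally an exterior square.  On paper = «(G°)^der ≅ SO₆ ≅ SL₄/μ₂ in its standard 6-dimensional module» (the outer D₃-automorphism is
killed by a quadratic extension, the spin lift exists geometrically over a CM quadratic extension: Patrikis, Mem. AMS 2019); closed under ⊗χ,
under restriction to solvable Galois L, and under descent. -/
def IsSolvablyExteriorSquare (ρ : Literature.NumberTheory.GaloisRepresentations.FramedGaloisRep K (PadicAlgCl ℓ) n) : Prop :=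
  ∃ (E : Type) (_ : Field E) (_ : NumberField E) (_ : Algebra K E), IsGalois K E ∧ IsSolvable (E ≃ₐ[K] E) ∧
    InTensorPrimitiveBox (ρ.restrictField E) ∧ IsRationalExteriorSquare (ρ.restrictField E)

end Vocabulary

/-! ## 2. Certificates (kernel-checked arithmetic of the cut) -/
section Certificates

/-- the ACCIDENTAL WINDOW is LARGE: ∧² of rank 4 has dimension C(4,2) = 6 and rank SL₄ = 3 = ⌊6/2⌋ — so the window must be carved BEFORE the
Cartan-rank test (it is: first excluded middle of `prim_of_cells`). -/
theorem window_is_large : Nat.choose 4 2 = 6 ∧ 4 - 1 = 6 / 2 := by decide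

/-- the other accidents are standard too: B₂ = C₂ (dim 5, rank 2 = ⌊5/2⌋), D₄-triality (dim 8, rank 4 = ⌊8/2⌋); and the smallest SMALL types:
Sym² SL₃ (dim 6, rank 2 < 3), G₂ (dim 7, rank 2 < 3), spin B₃ (dim 8, rank 3 < 4), ∧² SL₅ (dim 10, rank 4 < 5), Ad SL₃ (dim 8, rank 2 < 4). -/
theorem threshold_table : (2 = 5 / 2 ∧ 4 = 8 / 2) ∧ (2 < 6 / 2 ∧ 2 < 7 / 2 ∧ 3 < 8 / 2 ∧ Nat.choose 5 2 = 10 ∧ 4 < 10 / 2 ∧ 2 < 8 / 2) := by decide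

/-- the FUNDAMENTAL PLETHYSMS ∧^k SL_m (m ≥ 5, 2 ≤ k ≤ m - 2) are all SMALL: rank m - 1 < C(m,k)/2 (checked for 5 ≤ m ≤ 12; in general
C(m,k) ≥ C(m,2) = m(m-1)/2 > 2(m-1) for m ≥ 5). -/
theorem exterior_powers_small : ∀ m ∈ Finset.Icc 5 12, ∀ k ∈ Finset.Icc 2 10, k + 2 ≤ m → m - 1 < Nat.choose m k / 2 := by decide

/-- the Cartan-rank threshold is exhaustive and exclusive (excluded middle, recorded). -/
theorem rank_dichotomy (P : Prop) : (P ∨ ¬ P) ∧ ¬ (P ∧ ¬ P) := ⟨em P, fun h => h.2 h.1⟩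

end Certificates

/-! ## 3. The target BY NAME and its text (identity certified by `Iff.rfl`) -/

/-- PRIM in structured form (= the twin's `solvablyTensorPrimitiveAutomorphy_iff`, stated for the ROUTE decl of record). -/
theorem target_iff : KroneckerPrimitivitySplit.SolvablyTensorPrimitiveAutomorphy ↔
    ∀ (K : Type) [Field K] [NumberField K] (n : ℕ) (hcpt : Literature.NumberTheory.Automorphic.isCompact_glFiniteIntegralLevel n K), 3 ≤ n → RankIH n →
      ∀ (ℓ : ℕ) [Fact ℓ.Prime] (ι : PadicAlgCl ℓ ≃+* ℂ) (ρ : Literature.NumberTheory.GaloisRepresentations.FramedGaloisRep K (PadicAlgCl ℓ) n), ρ.toGaloisRep.IsIrreducible → PinnedGeometric ρ →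
        IsLieIrreducible ρ → ¬ HasProgressionSpectra ρ → ¬ IsSolvablyKronecker ρ → WeakAutomorphic hcpt ι ρ := Iff.rfl

/-- PRIM's tree text (route-Langlands-KroneckerPrimitivitySplit rev 0, 4733 chars) — the cells below are this text with ONE inserted hypothesis each. -/
theorem target_text_iff : KroneckerPrimitivitySplit.SolvablyTensorPrimitiveAutomorphy ↔ ∀ (K : Type) [Field K] [NumberField K] (n : ℕ) (hcpt : Literature.NumberTheory.Automorphic.isCompact_glFiniteIntegralLevel n K), 3 ≤ n → (∀ (m : ℕ), 2 ≤ m → m < n → ∀ (E : Type) [Field E] [NumberField E] (hE : Literature.NumberTheory.Automorphic.isCompact_glFiniteIntegralLevel m E) (ℓ' : ℕ) [Fact ℓ'.Prime] (ι' : PadicAlgCl ℓ' ≃+* ℂ) (σ : Literature.NumberTheory.GaloisRepresentations.FramedGaloisRep E (PadicAlgCl ℓ') m), σ.toGaloisRep.IsIrreducible → ((∀ᶠ v : IsDedekindDomain.HeightOneSpectrum (NumberField.RingOfIntegers E) in Filter.cofinite, σ.IsUnramifiedAt v) ∧ ∀ (v : IsDedekindDomain.HeightOneSpectrum (NumberField.RingOfIntegers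 E)) (hv : ((ℓ' : ℕ) : NumberField.RingOfIntegers E) ∈ v.asIdeal), (Literature.NumberTheory.PAdicHodge.fontainePstAdicCompletion v ℓ' hv).IsDeRhamFramed (σ.toLocal v)) → (∀ (L : Type) [Field L] [NumberField L] [Algebra E L], (σ.restrictField L).toGaloisRep.IsIrreducible) → ∃ π : Literature.NumberTheory.Automorphic.CuspidalAutomorphicRepData m E hE, π.1.IsLAlgebraic ∧ ∀ᶠ v : IsDedekindDomain.HeightOneSpectrum (NumberField.RingOfIntegers E) in Filter.cofinite, SatakeFrobCompatibleAt ι' π.1 σ v) → ∀ (ℓ : ℕ) [Fact ℓ.Prime] (ι : PadicAlgCl ℓ ≃+* ℂ) (ρ : Literature.NumberTheory.GaloisRepresentations.FramedGaloisRep K (PadicAlgCl ℓ) n), ρ.toGaloisRep.IsIrreducible → ((∀ᶠ v : IsDedekindDomain.HeightOneSpectrum (NumberField.RingOfIntegers K) in Filter.cofinite, ρ.IsUnramifiedAt v) ∧ ∀ (v : IsDedekindDomain.HeightOneSpectrum (NumberField.RingOfIntegers K)) (hv : ((ℓ : ℕ) : NumberField.RingOfIntegers K) ∈ v.asIdeal),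 (Literature.NumberTheory.PAdicHodge.fontainePstAdicCompletion v ℓ hv).IsDeRhamFramed (ρ.toLocal v)) → (∀ (L : Type) [Field L] [NumberField L] [Algebra K L], (ρ.restrictField L).toGaloisRep.IsIrreducible) → ¬ (∃ U : Set (Field.absoluteGaloisGroup K), IsOpen U ∧ (1 : Field.absoluteGaloisGroup K) ∈ U ∧ ∀ g ∈ U, ∃ c r : PadicAlgCl ℓ, Literature.NumberTheory.GaloisRepresentations.FramedRep.charpoly ρ g = ∏ j ∈ Finset.range n, (Polynomial.X - Polynomial.C (c * r ^ j))) → ¬ (∃ (E : Type) (_ : Field E) (_ : NumberField E) (_ : Algebra K E), IsGalois K E ∧ IsSolvable (E ≃ₐ[K] E) ∧ ((ρ.restrictField E).toGaloisRep.IsIrreducible ∧ ((∀ᶠ v : IsDedekindDomain.HeightOneSpectrum (NumberField.RingOfIntegers E) in Filter.cofinite, (ρ.restrictField E).IsUnramifiedAt v) ∧ ∀ (v : IsDedekindDomain.HeightOneSpectrum (NumberField.RingOfIntegers E)) (hv : ((ℓ : ℕ) : NumberField.RingOfIntegers E) ∈ v.asIdeal), (Literature.NumberTheory.PAdicHodge.fontainePstAdicCompletion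 v ℓ hv).IsDeRhamFramed ((ρ.restrictField E).toLocal v)) ∧ (∀ (L : Type) [Field L] [NumberField L] [Algebra E L], ((ρ.restrictField E).restrictField L).toGaloisRep.IsIrreducible) ∧ ¬ (∃ U : Set (Field.absoluteGaloisGroup E), IsOpen U ∧ (1 : Field.absoluteGaloisGroup E) ∈ U ∧ ∀ g ∈ U, ∃ c r : PadicAlgCl ℓ, Literature.NumberTheory.GaloisRepresentations.FramedRep.charpoly (ρ.restrictField E) g = ∏ j ∈ Finset.range n, (Polynomial.X - Polynomial.C (c * r ^ j)))) ∧ (∃ (a b : ℕ) (ρ₁ : Literature.NumberTheory.GaloisRepresentations.FramedGaloisRep E (PadicAlgCl ℓ) a) (ρ₂ : Literature.NumberTheory.GaloisRepresentations.FramedGaloisRep E (PadicAlgCl ℓ) b), 2 ≤ a ∧ 2 ≤ b ∧ n = a * b ∧ (ρ₁.toGaloisRep.IsIrreducible ∧ ((∀ᶠ v : IsDedekindDomain.HeightOneSpectrum (NumberField.RingOfIntegers E) in Filter.cofinite, ρ₁.IsUnramifiedAt v) ∧ ∀ (v : IsDedekindDomain.HeightOneSpectrum (NumberField.RingOfIntegers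 E)) (hv : ((ℓ : ℕ) : NumberField.RingOfIntegers E) ∈ v.asIdeal), (Literature.NumberTheory.PAdicHodge.fontainePstAdicCompletion v ℓ hv).IsDeRhamFramed (ρ₁.toLocal v)) ∧ (∀ (L : Type) [Field L] [NumberField L] [Algebra E L], (ρ₁.restrictField L).toGaloisRep.IsIrreducible)) ∧ (ρ₂.toGaloisRep.IsIrreducible ∧ ((∀ᶠ v : IsDedekindDomain.HeightOneSpectrum (NumberField.RingOfIntegers E) in Filter.cofinite, ρ₂.IsUnramifiedAt v) ∧ ∀ (v : IsDedekindDomain.HeightOneSpectrum (NumberField.RingOfIntegers E)) (hv : ((ℓ : ℕ) : NumberField.RingOfIntegers E) ∈ v.asIdeal), (Literature.NumberTheory.PAdicHodge.fontainePstAdicCompletion v ℓ hv).IsDeRhamFramed (ρ₂.toLocal v)) ∧ (∀ (L : Type) [Field L] [NumberField L] [Algebra E L], (ρ₂.restrictField L).toGaloisRep.IsIrreducible)) ∧ ∀ g : Field.absoluteGaloisGroup E, Literature.NumberTheory.GaloisRepresentations.FramedRep.charpoly (ρ.restrictField E) g = (Matrix.kroneckerMap (· * ·) ((ρ₁ g :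 GL (Fin a) (PadicAlgCl ℓ)) : Matrix (Fin a) (Fin a) (PadicAlgCl ℓ)) ((ρ₂ g : GL (Fin b) (PadicAlgCl ℓ)) : Matrix (Fin b) (Fin b) (PadicAlgCl ℓ))).charpoly)) → ∃ π : Literature.NumberTheory.Automorphic.CuspidalAutomorphicRepData n K hcpt, π.1.IsLAlgebraic ∧ ∀ᶠ v : IsDedekindDomain.HeightOneSpectrum (NumberField.RingOfIntegers K) in Filter.cofinite, SatakeFrobCompatibleAt ι π.1 ρ v := Iff.rfl

/-! ## 4. THE ITEMS (inlined one-liners over existing tree declarations = childroute.items.json `statement` VERBATIM) -/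

/-- ACC · crux 2 · WEAKER · ATTACKABLE-NOW (closable modulo print: rank-IH for σ on GL₄ + `Kim2003_exteriorSquare_GL4` + Asgari–Raghuram
cuspidality + `Kim2003_exteriorSquare_GL4_archimedean.exists_lift_isLAlgebraic` + twist) — the ATTACKED CONJUNCT.  GIVEN the rank-IH, clause (B)
for the PRIM-box ρ that are K-RATIONALLY AN EXTERIOR SQUARE (n = 6). -/
def AccidentalWindowTransport : Prop :=
  ∀ (K : Type) [Field K] [NumberField K] (n : ℕ) (hcpt : Literature.NumberTheory.Automorphic.isCompact_glFiniteIntegralLevel n K), 3 ≤ n → (∀ (m : ℕ), 2 ≤ m → m < n → ∀ (E : Type) [Field E] [NumberField E] (hE : Literature.NumberTheory.Automorphic.isCompact_glFiniteIntegralLevel m E) (ℓ' : ℕ) [Fact ℓ'.Prime] (ι' : PadicAlgCl ℓ' ≃+* ℂ) (σ : Literature.NumberTheory.GaloisRepresentations.FramedGaloisRep E (PadicAlgCl ℓ') m), σ.toGaloisRep.IsIrreducible → ((∀ᶠ v : IsDedekindDomain.HeightOneSpectrum (NumberField.RingOfIntegers E) in Filter.cofinite, σ.IsUnramifiedAt v)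 ∧ ∀ (v : IsDedekindDomain.HeightOneSpectrum (NumberField.RingOfIntegers E)) (hv : ((ℓ' : ℕ) : NumberField.RingOfIntegers E) ∈ v.asIdeal), (Literature.NumberTheory.PAdicHodge.fontainePstAdicCompletion v ℓ' hv).IsDeRhamFramed (σ.toLocal v)) → (∀ (L : Type) [Field L] [NumberField L] [Algebra E L], (σ.restrictField L).toGaloisRep.IsIrreducible) → ∃ π : Literature.NumberTheory.Automorphic.CuspidalAutomorphicRepData m E hE, π.1.IsLAlgebraic ∧ ∀ᶠ v : IsDedekindDomain.HeightOneSpectrum (NumberField.RingOfIntegers E) in Filter.cofinite, SatakeFrobCompatibleAt ι' π.1 σ v) → ∀ (ℓ : ℕ) [Fact ℓ.Prime] (ι : PadicAlgCl ℓ ≃+* ℂ) (ρ : Literature.NumberTheory.GaloisRepresentations.FramedGaloisRep K (PadicAlgCl ℓ) n), ρ.toGaloisRep.IsIrreducible → ((∀ᶠ v : IsDedekindDomain.HeightOneSpectrum (NumberField.RingOfIntegers K) in Filter.cofinite, ρ.IsUnramifiedAt v) ∧ ∀ (v : IsDedekindDomain.HeightOneSpectrum (NumberField.RingOfIntegers K))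 (hv : ((ℓ : ℕ) : NumberField.RingOfIntegers K) ∈ v.asIdeal), (Literature.NumberTheory.PAdicHodge.fontainePstAdicCompletion v ℓ hv).IsDeRhamFramed (ρ.toLocal v)) → (∀ (L : Type) [Field L] [NumberField L] [Algebra K L], (ρ.restrictField L).toGaloisRep.IsIrreducible) → ¬ (∃ U : Set (Field.absoluteGaloisGroup K), IsOpen U ∧ (1 : Field.absoluteGaloisGroup K) ∈ U ∧ ∀ g ∈ U, ∃ c r : PadicAlgCl ℓ, Literature.NumberTheory.GaloisRepresentations.FramedRep.charpoly ρ g = ∏ j ∈ Finset.range n, (Polynomial.X - Polynomial.C (c * r ^ j))) → ¬ (∃ (E : Type) (_ : Field E) (_ : NumberField E) (_ : Algebra K E), IsGalois K E ∧ IsSolvable (E ≃ₐ[K] E) ∧ ((ρ.restrictField E).toGaloisRep.IsIrreducible ∧ ((∀ᶠ v : IsDedekindDomain.HeightOneSpectrum (NumberField.RingOfIntegers E) in Filter.cofinite, (ρ.restrictField E).IsUnramifiedAt v) ∧ ∀ (v : IsDedekindDomain.HeightOneSpectrum (NumberField.RingOfIntegers E)) (hv : ((ℓ : ℕ) : NumberField.RingOfIntegers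 E) ∈ v.asIdeal), (Literature.NumberTheory.PAdicHodge.fontainePstAdicCompletion v ℓ hv).IsDeRhamFramed ((ρ.restrictField E).toLocal v)) ∧ (∀ (L : Type) [Field L] [NumberField L] [Algebra E L], ((ρ.restrictField E).restrictField L).toGaloisRep.IsIrreducible) ∧ ¬ (∃ U : Set (Field.absoluteGaloisGroup E), IsOpen U ∧ (1 : Field.absoluteGaloisGroup E) ∈ U ∧ ∀ g ∈ U, ∃ c r : PadicAlgCl ℓ, Literature.NumberTheory.GaloisRepresentations.FramedRep.charpoly (ρ.restrictField E) g = ∏ j ∈ Finset.range n, (Polynomial.X - Polynomial.C (c * r ^ j)))) ∧ (∃ (a b : ℕ) (ρ₁ : Literature.NumberTheory.GaloisRepresentations.FramedGaloisRep E (PadicAlgCl ℓ) a) (ρ₂ : Literature.NumberTheory.GaloisRepresentations.FramedGaloisRep E (PadicAlgCl ℓ) b), 2 ≤ a ∧ 2 ≤ b ∧ n = a * b ∧ (ρ₁.toGaloisRep.IsIrreducible ∧ ((∀ᶠ v : IsDedekindDomain.HeightOneSpectrum (NumberField.RingOfIntegers E) in Filter.cofinite, ρ₁.IsUnramifiedAt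 v) ∧ ∀ (v : IsDedekindDomain.HeightOneSpectrum (NumberField.RingOfIntegers E)) (hv : ((ℓ : ℕ) : NumberField.RingOfIntegers E) ∈ v.asIdeal), (Literature.NumberTheory.PAdicHodge.fontainePstAdicCompletion v ℓ hv).IsDeRhamFramed (ρ₁.toLocal v)) ∧ (∀ (L : Type) [Field L] [NumberField L] [Algebra E L], (ρ₁.restrictField L).toGaloisRep.IsIrreducible)) ∧ (ρ₂.toGaloisRep.IsIrreducible ∧ ((∀ᶠ v : IsDedekindDomain.HeightOneSpectrum (NumberField.RingOfIntegers E) in Filter.cofinite, ρ₂.IsUnramifiedAt v) ∧ ∀ (v : IsDedekindDomain.HeightOneSpectrum (NumberField.RingOfIntegers E)) (hv : ((ℓ : ℕ) : NumberField.RingOfIntegers E) ∈ v.asIdeal), (Literature.NumberTheory.PAdicHodge.fontainePstAdicCompletion v ℓ hv).IsDeRhamFramed (ρ₂.toLocal v)) ∧ (∀ (L : Type) [Field L] [NumberField L] [Algebra E L], (ρ₂.restrictField L).toGaloisRep.IsIrreducible)) ∧ ∀ g : Field.absoluteGaloisGroup E, Literature.NumberTheory.GaloisRepresentations.FramedRep.charpoly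 (ρ.restrictField E) g = (Matrix.kroneckerMap (· * ·) ((ρ₁ g : GL (Fin a) (PadicAlgCl ℓ)) : Matrix (Fin a) (Fin a) (PadicAlgCl ℓ)) ((ρ₂ g : GL (Fin b) (PadicAlgCl ℓ)) : Matrix (Fin b) (Fin b) (PadicAlgCl ℓ))).charpoly)) → (n = 6 ∧ ∃ (σ : Literature.NumberTheory.GaloisRepresentations.FramedGaloisRep K (PadicAlgCl ℓ) 4) (χ : Literature.NumberTheory.GaloisRepresentations.FramedGaloisRep K (PadicAlgCl ℓ) 1), (σ.toGaloisRep.IsIrreducible ∧ ((∀ᶠ v : IsDedekindDomain.HeightOneSpectrum (NumberField.RingOfIntegers K) in Filter.cofinite, σ.IsUnramifiedAt v) ∧ ∀ (v : IsDedekindDomain.HeightOneSpectrum (NumberField.RingOfIntegers K)) (hv : ((ℓ : ℕ) : NumberField.RingOfIntegers K) ∈ v.asIdeal), (Literature.NumberTheory.PAdicHodge.fontainePstAdicCompletion v ℓ hv).IsDeRhamFramed (σ.toLocal v)) ∧ (∀ (L : Type) [Field L] [NumberField L] [Algebra K L], (σ.restrictField L).toGaloisRep.IsIrreducible)) ∧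 ((∀ᶠ v : IsDedekindDomain.HeightOneSpectrum (NumberField.RingOfIntegers K) in Filter.cofinite, χ.IsUnramifiedAt v) ∧ ∀ (v : IsDedekindDomain.HeightOneSpectrum (NumberField.RingOfIntegers K)) (hv : ((ℓ : ℕ) : NumberField.RingOfIntegers K) ∈ v.asIdeal), (Literature.NumberTheory.PAdicHodge.fontainePstAdicCompletion v ℓ hv).IsDeRhamFramed (χ.toLocal v)) ∧ ∀ g : Field.absoluteGaloisGroup K, (Literature.NumberTheory.GaloisRepresentations.FramedRep.charpoly ρ g).roots = (((Literature.NumberTheory.GaloisRepresentations.FramedRep.charpoly σ g).roots.powersetCard 2).map Multiset.prod).map (fun x => Literature.NumberTheory.GaloisRepresentations.FramedRep.trace χ g * x)) → ∃ π : Literature.NumberTheory.Automorphic.CuspidalAutomorphicRepData n K hcpt, π.1.IsLAlgebraic ∧ ∀ᶠ v : IsDedekindDomain.HeightOneSpectrum (NumberField.RingOfIntegers K) in Filter.cofinite, SatakeFrobCompatibleAt ι π.1 ρ v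

/-- SMALL · crux 3 · WEAKER · IDEA-NEEDED (residual conjunct: the named open functorialities from lower-rank groups).  GIVEN the rank-IH,
clause (B) for the PRIM-box ρ of CARTAN RANK < ⌊n/2⌋. -/
def SmallTypeTransport : Prop :=
  ∀ (K : Type) [Field K] [NumberField K] (n : ℕ) (hcpt : Literature.NumberTheory.Automorphic.isCompact_glFiniteIntegralLevel n K), 3 ≤ n → (∀ (m : ℕ), 2 ≤ m → m < n → ∀ (E : Type) [Field E] [NumberField E] (hE : Literature.NumberTheory.Automorphic.isCompact_glFiniteIntegralLevel m E) (ℓ' : ℕ) [Fact ℓ'.Prime] (ι' : PadicAlgCl ℓ' ≃+* ℂ) (σ : Literature.NumberTheory.GaloisRepresentations.FramedGaloisRep E (PadicAlgCl ℓ') m), σ.toGaloisRep.IsIrreducible → ((∀ᶠ v : IsDedekindDomain.HeightOneSpectrum (NumberField.RingOfIntegers E) in Filter.cofinite, σ.IsUnramifiedAt v) ∧ ∀ (v : IsDedekindDomain.HeightOneSpectrum (NumberField.RingOfIntegers E)) (hv : ((ℓ' : ℕ) : NumberField.RingOfIntegers E) ∈ v.asIdeal), (Literature.NumberTheory.PAdicHodge.fontainePstAdicCompletion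 v ℓ' hv).IsDeRhamFramed (σ.toLocal v)) → (∀ (L : Type) [Field L] [NumberField L] [Algebra E L], (σ.restrictField L).toGaloisRep.IsIrreducible) → ∃ π : Literature.NumberTheory.Automorphic.CuspidalAutomorphicRepData m E hE, π.1.IsLAlgebraic ∧ ∀ᶠ v : IsDedekindDomain.HeightOneSpectrum (NumberField.RingOfIntegers E) in Filter.cofinite, SatakeFrobCompatibleAt ι' π.1 σ v) → ∀ (ℓ : ℕ) [Fact ℓ.Prime] (ι : PadicAlgCl ℓ ≃+* ℂ) (ρ : Literature.NumberTheory.GaloisRepresentations.FramedGaloisRep K (PadicAlgCl ℓ) n), ρ.toGaloisRep.IsIrreducible → ((∀ᶠ v : IsDedekindDomain.HeightOneSpectrum (NumberField.RingOfIntegers K) in Filter.cofinite, ρ.IsUnramifiedAt v) ∧ ∀ (v : IsDedekindDomain.HeightOneSpectrum (NumberField.RingOfIntegers K)) (hv : ((ℓ : ℕ) : NumberField.RingOfIntegers K) ∈ v.asIdeal), (Literature.NumberTheory.PAdicHodge.fontainePstAdicCompletion v ℓ hv).IsDeRhamFramed (ρ.toLocal v)) → (∀ (L : Type) [Field L] [NumberField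 L] [Algebra K L], (ρ.restrictField L).toGaloisRep.IsIrreducible) → ¬ (∃ U : Set (Field.absoluteGaloisGroup K), IsOpen U ∧ (1 : Field.absoluteGaloisGroup K) ∈ U ∧ ∀ g ∈ U, ∃ c r : PadicAlgCl ℓ, Literature.NumberTheory.GaloisRepresentations.FramedRep.charpoly ρ g = ∏ j ∈ Finset.range n, (Polynomial.X - Polynomial.C (c * r ^ j))) → ¬ (∃ (E : Type) (_ : Field E) (_ : NumberField E) (_ : Algebra K E), IsGalois K E ∧ IsSolvable (E ≃ₐ[K] E) ∧ ((ρ.restrictField E).toGaloisRep.IsIrreducible ∧ ((∀ᶠ v : IsDedekindDomain.HeightOneSpectrum (NumberField.RingOfIntegers E) in Filter.cofinite, (ρ.restrictField E).IsUnramifiedAt v) ∧ ∀ (v : IsDedekindDomain.HeightOneSpectrum (NumberField.RingOfIntegers E)) (hv : ((ℓ : ℕ) : NumberField.RingOfIntegers E) ∈ v.asIdeal), (Literature.NumberTheory.PAdicHodge.fontainePstAdicCompletion v ℓ hv).IsDeRhamFramed ((ρ.restrictField E).toLocal v)) ∧ (∀ (L : Type) [Field L] [NumberField L] [Algebra E L],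 ((ρ.restrictField E).restrictField L).toGaloisRep.IsIrreducible) ∧ ¬ (∃ U : Set (Field.absoluteGaloisGroup E), IsOpen U ∧ (1 : Field.absoluteGaloisGroup E) ∈ U ∧ ∀ g ∈ U, ∃ c r : PadicAlgCl ℓ, Literature.NumberTheory.GaloisRepresentations.FramedRep.charpoly (ρ.restrictField E) g = ∏ j ∈ Finset.range n, (Polynomial.X - Polynomial.C (c * r ^ j)))) ∧ (∃ (a b : ℕ) (ρ₁ : Literature.NumberTheory.GaloisRepresentations.FramedGaloisRep E (PadicAlgCl ℓ) a) (ρ₂ : Literature.NumberTheory.GaloisRepresentations.FramedGaloisRep E (PadicAlgCl ℓ) b), 2 ≤ a ∧ 2 ≤ b ∧ n = a * b ∧ (ρ₁.toGaloisRep.IsIrreducible ∧ ((∀ᶠ v : IsDedekindDomain.HeightOneSpectrum (NumberField.RingOfIntegers E) in Filter.cofinite, ρ₁.IsUnramifiedAt v) ∧ ∀ (v : IsDedekindDomain.HeightOneSpectrum (NumberField.RingOfIntegers E)) (hv : ((ℓ : ℕ) : NumberField.RingOfIntegers E) ∈ v.asIdeal), (Literature.NumberTheory.PAdicHodge.fontainePstAdicCompletion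 v ℓ hv).IsDeRhamFramed (ρ₁.toLocal v)) ∧ (∀ (L : Type) [Field L] [NumberField L] [Algebra E L], (ρ₁.restrictField L).toGaloisRep.IsIrreducible)) ∧ (ρ₂.toGaloisRep.IsIrreducible ∧ ((∀ᶠ v : IsDedekindDomain.HeightOneSpectrum (NumberField.RingOfIntegers E) in Filter.cofinite, ρ₂.IsUnramifiedAt v) ∧ ∀ (v : IsDedekindDomain.HeightOneSpectrum (NumberField.RingOfIntegers E)) (hv : ((ℓ : ℕ) : NumberField.RingOfIntegers E) ∈ v.asIdeal), (Literature.NumberTheory.PAdicHodge.fontainePstAdicCompletion v ℓ hv).IsDeRhamFramed (ρ₂.toLocal v)) ∧ (∀ (L : Type) [Field L] [NumberField L] [Algebra E L], (ρ₂.restrictField L).toGaloisRep.IsIrreducible)) ∧ ∀ g : Field.absoluteGaloisGroup E, Literature.NumberTheory.GaloisRepresentations.FramedRep.charpoly (ρ.restrictField E) g = (Matrix.kroneckerMap (· * ·) ((ρ₁ g : GL (Fin a) (PadicAlgCl ℓ)) : Matrix (Fin a) (Fin a) (PadicAlgCl ℓ)) ((ρ₂ g : GL (Fin b) (PadicAlgCl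 ℓ)) : Matrix (Fin b) (Fin b) (PadicAlgCl ℓ))).charpoly)) → ¬ (∀ U : Set (Field.absoluteGaloisGroup K), IsOpen U → (1 : Field.absoluteGaloisGroup K) ∈ U → ∃ g ∈ U, ∃ e : Fin n → PadicAlgCl ℓ, (Literature.NumberTheory.GaloisRepresentations.FramedRep.charpoly ρ g).roots = (Finset.univ : Finset (Fin n)).val.map e ∧ ∃ ij : Fin (n / 2) → Fin n × Fin n, ∀ a : Fin (n / 2) → ℤ, (∏ t : Fin (n / 2), (e (ij t).1 / e (ij t).2) ^ (a t)) = 1 → a = 0) → ∃ π : Literature.NumberTheory.Automorphic.CuspidalAutomorphicRepData n K hcpt, π.1.IsLAlgebraic ∧ ∀ᶠ v : IsDedekindDomain.HeightOneSpectrum (NumberField.RingOfIntegers K) in Filter.cofinite, SatakeFrobCompatibleAt ι π.1 ρ v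

/-- STD · crux 4 · WEAKER · NEW DECLARED RESIDUAL · UNDECIDED (transport-terminal standard classical type).  GIVEN the rank-IH, clause (B) for
the PRIM-box ρ of CARTAN RANK ≥ ⌊n/2⌋ that are NOT solvably an exterior square. -/
def StandardTypeAutomorphy : Prop :=
  ∀ (K : Type) [Field K] [NumberField K] (n : ℕ) (hcpt : Literature.NumberTheory.Automorphic.isCompact_glFiniteIntegralLevel n K), 3 ≤ n → (∀ (m : ℕ), 2 ≤ m → m < n → ∀ (E : Type) [Field E] [NumberField E] (hE : Literature.NumberTheory.Automorphic.isCompact_glFiniteIntegralLevel m E) (ℓ' : ℕ) [Fact ℓ'.Prime] (ι' : PadicAlgCl ℓ' ≃+* ℂ) (σ : Literature.NumberTheory.GaloisRepresentations.FramedGaloisRep E (PadicAlgCl ℓ') m), σ.toGaloisRep.IsIrreducible → ((∀ᶠ v : IsDedekindDomain.HeightOneSpectrum (NumberField.RingOfIntegers E) in Filter.cofinite, σ.IsUnramifiedAt v) ∧ ∀ (v : IsDedekindDomain.HeightOneSpectrum (NumberField.RingOfIntegers E)) (hv : ((ℓ' : ℕ) : NumberField.RingOfIntegers E) ∈ v.asIdeal),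 (Literature.NumberTheory.PAdicHodge.fontainePstAdicCompletion v ℓ' hv).IsDeRhamFramed (σ.toLocal v)) → (∀ (L : Type) [Field L] [NumberField L] [Algebra E L], (σ.restrictField L).toGaloisRep.IsIrreducible) → ∃ π : Literature.NumberTheory.Automorphic.CuspidalAutomorphicRepData m E hE, π.1.IsLAlgebraic ∧ ∀ᶠ v : IsDedekindDomain.HeightOneSpectrum (NumberField.RingOfIntegers E) in Filter.cofinite, SatakeFrobCompatibleAt ι' π.1 σ v) → ∀ (ℓ : ℕ) [Fact ℓ.Prime] (ι : PadicAlgCl ℓ ≃+* ℂ) (ρ : Literature.NumberTheory.GaloisRepresentations.FramedGaloisRep K (PadicAlgCl ℓ) n), ρ.toGaloisRep.IsIrreducible → ((∀ᶠ v : IsDedekindDomain.HeightOneSpectrum (NumberField.RingOfIntegers K) in Filter.cofinite, ρ.IsUnramifiedAt v) ∧ ∀ (v : IsDedekindDomain.HeightOneSpectrum (NumberField.RingOfIntegers K)) (hv : ((ℓ : ℕ) : NumberField.RingOfIntegers K) ∈ v.asIdeal), (Literature.NumberTheory.PAdicHodge.fontainePstAdicCompletion v ℓ hv).IsDeRhamFramed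 (ρ.toLocal v)) → (∀ (L : Type) [Field L] [NumberField L] [Algebra K L], (ρ.restrictField L).toGaloisRep.IsIrreducible) → ¬ (∃ U : Set (Field.absoluteGaloisGroup K), IsOpen U ∧ (1 : Field.absoluteGaloisGroup K) ∈ U ∧ ∀ g ∈ U, ∃ c r : PadicAlgCl ℓ, Literature.NumberTheory.GaloisRepresentations.FramedRep.charpoly ρ g = ∏ j ∈ Finset.range n, (Polynomial.X - Polynomial.C (c * r ^ j))) → ¬ (∃ (E : Type) (_ : Field E) (_ : NumberField E) (_ : Algebra K E), IsGalois K E ∧ IsSolvable (E ≃ₐ[K] E) ∧ ((ρ.restrictField E).toGaloisRep.IsIrreducible ∧ ((∀ᶠ v : IsDedekindDomain.HeightOneSpectrum (NumberField.RingOfIntegers E) in Filter.cofinite, (ρ.restrictField E).IsUnramifiedAt v) ∧ ∀ (v : IsDedekindDomain.HeightOneSpectrum (NumberField.RingOfIntegers E)) (hv : ((ℓ : ℕ) : NumberField.RingOfIntegers E) ∈ v.asIdeal), (Literature.NumberTheory.PAdicHodge.fontainePstAdicCompletion v ℓ hv).IsDeRhamFramed ((ρ.restrictField E).toLocal v)) ∧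 (∀ (L : Type) [Field L] [NumberField L] [Algebra E L], ((ρ.restrictField E).restrictField L).toGaloisRep.IsIrreducible) ∧ ¬ (∃ U : Set (Field.absoluteGaloisGroup E), IsOpen U ∧ (1 : Field.absoluteGaloisGroup E) ∈ U ∧ ∀ g ∈ U, ∃ c r : PadicAlgCl ℓ, Literature.NumberTheory.GaloisRepresentations.FramedRep.charpoly (ρ.restrictField E) g = ∏ j ∈ Finset.range n, (Polynomial.X - Polynomial.C (c * r ^ j)))) ∧ (∃ (a b : ℕ) (ρ₁ : Literature.NumberTheory.GaloisRepresentations.FramedGaloisRep E (PadicAlgCl ℓ) a) (ρ₂ : Literature.NumberTheory.GaloisRepresentations.FramedGaloisRep E (PadicAlgCl ℓ) b), 2 ≤ a ∧ 2 ≤ b ∧ n = a * b ∧ (ρ₁.toGaloisRep.IsIrreducible ∧ ((∀ᶠ v : IsDedekindDomain.HeightOneSpectrum (NumberField.RingOfIntegers E) in Filter.cofinite, ρ₁.IsUnramifiedAt v) ∧ ∀ (v : IsDedekindDomain.HeightOneSpectrum (NumberField.RingOfIntegers E)) (hv : ((ℓ : ℕ) : NumberField.RingOfIntegers E) ∈ v.asIdeal),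 (Literature.NumberTheory.PAdicHodge.fontainePstAdicCompletion v ℓ hv).IsDeRhamFramed (ρ₁.toLocal v)) ∧ (∀ (L : Type) [Field L] [NumberField L] [Algebra E L], (ρ₁.restrictField L).toGaloisRep.IsIrreducible)) ∧ (ρ₂.toGaloisRep.IsIrreducible ∧ ((∀ᶠ v : IsDedekindDomain.HeightOneSpectrum (NumberField.RingOfIntegers E) in Filter.cofinite, ρ₂.IsUnramifiedAt v) ∧ ∀ (v : IsDedekindDomain.HeightOneSpectrum (NumberField.RingOfIntegers E)) (hv : ((ℓ : ℕ) : NumberField.RingOfIntegers E) ∈ v.asIdeal), (Literature.NumberTheory.PAdicHodge.fontainePstAdicCompletion v ℓ hv).IsDeRhamFramed (ρ₂.toLocal v)) ∧ (∀ (L : Type) [Field L] [NumberField L] [Algebra E L], (ρ₂.restrictField L).toGaloisRep.IsIrreducible)) ∧ ∀ g : Field.absoluteGaloisGroup E, Literature.NumberTheory.GaloisRepresentations.FramedRep.charpoly (ρ.restrictField E) g = (Matrix.kroneckerMap (· * ·) ((ρ₁ g : GL (Fin a) (PadicAlgCl ℓ)) : Matrix (Fin a) (Fin a) (PadicAlgCl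 ℓ)) ((ρ₂ g : GL (Fin b) (PadicAlgCl ℓ)) : Matrix (Fin b) (Fin b) (PadicAlgCl ℓ))).charpoly)) → ((∀ U : Set (Field.absoluteGaloisGroup K), IsOpen U → (1 : Field.absoluteGaloisGroup K) ∈ U → ∃ g ∈ U, ∃ e : Fin n → PadicAlgCl ℓ, (Literature.NumberTheory.GaloisRepresentations.FramedRep.charpoly ρ g).roots = (Finset.univ : Finset (Fin n)).val.map e ∧ ∃ ij : Fin (n / 2) → Fin n × Fin n, ∀ a : Fin (n / 2) → ℤ, (∏ t : Fin (n / 2), (e (ij t).1 / e (ij t).2) ^ (a t)) = 1 → a = 0) ∧ ¬ (∃ (E : Type) (_ : Field E) (_ : NumberField E) (_ : Algebra K E), IsGalois K E ∧ IsSolvable (E ≃ₐ[K] E) ∧ (((ρ.restrictField E).toGaloisRep.IsIrreducible ∧ ((∀ᶠ v : IsDedekindDomain.HeightOneSpectrum (NumberField.RingOfIntegers E) in Filter.cofinite, (ρ.restrictField E).IsUnramifiedAt v) ∧ ∀ (v : IsDedekindDomain.HeightOneSpectrum (NumberField.RingOfIntegers E)) (hv : ((ℓ : ℕ) : NumberField.RingOfIntegers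 E) ∈ v.asIdeal), (Literature.NumberTheory.PAdicHodge.fontainePstAdicCompletion v ℓ hv).IsDeRhamFramed ((ρ.restrictField E).toLocal v)) ∧ (∀ (L : Type) [Field L] [NumberField L] [Algebra E L], ((ρ.restrictField E).restrictField L).toGaloisRep.IsIrreducible) ∧ ¬ (∃ U : Set (Field.absoluteGaloisGroup E), IsOpen U ∧ (1 : Field.absoluteGaloisGroup E) ∈ U ∧ ∀ g ∈ U, ∃ c r : PadicAlgCl ℓ, Literature.NumberTheory.GaloisRepresentations.FramedRep.charpoly (ρ.restrictField E) g = ∏ j ∈ Finset.range n, (Polynomial.X - Polynomial.C (c * r ^ j)))) ∧ ¬ (∃ (E' : Type) (_ : Field E') (_ : NumberField E') (_ : Algebra E E'), IsGalois E E' ∧ IsSolvable (E' ≃ₐ[E] E') ∧ (((ρ.restrictField E).restrictField E').toGaloisRep.IsIrreducible ∧ ((∀ᶠ v : IsDedekindDomain.HeightOneSpectrum (NumberField.RingOfIntegers E') in Filter.cofinite, ((ρ.restrictField E).restrictField E').IsUnramifiedAt v) ∧ ∀ (v : IsDedekindDomain.HeightOneSpectrum (NumberField.RingOfIntegers E'))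 (hv : ((ℓ : ℕ) : NumberField.RingOfIntegers E') ∈ v.asIdeal), (Literature.NumberTheory.PAdicHodge.fontainePstAdicCompletion v ℓ hv).IsDeRhamFramed (((ρ.restrictField E).restrictField E').toLocal v)) ∧ (∀ (L : Type) [Field L] [NumberField L] [Algebra E' L], (((ρ.restrictField E).restrictField E').restrictField L).toGaloisRep.IsIrreducible) ∧ ¬ (∃ U : Set (Field.absoluteGaloisGroup E'), IsOpen U ∧ (1 : Field.absoluteGaloisGroup E') ∈ U ∧ ∀ g ∈ U, ∃ c r : PadicAlgCl ℓ, Literature.NumberTheory.GaloisRepresentations.FramedRep.charpoly ((ρ.restrictField E).restrictField E') g = ∏ j ∈ Finset.range n, (Polynomial.X - Polynomial.C (c * r ^ j)))) ∧ (∃ (a b : ℕ) (ρ₁ : Literature.NumberTheory.GaloisRepresentations.FramedGaloisRep E' (PadicAlgCl ℓ) a) (ρ₂ : Literature.NumberTheory.GaloisRepresentations.FramedGaloisRep E' (PadicAlgCl ℓ) b), 2 ≤ a ∧ 2 ≤ b ∧ n = a * b ∧ (ρ₁.toGaloisRep.IsIrreducible ∧ ((∀ᶠ v : IsDedekindDomain.HeightOneSpectrum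 (NumberField.RingOfIntegers E') in Filter.cofinite, ρ₁.IsUnramifiedAt v) ∧ ∀ (v : IsDedekindDomain.HeightOneSpectrum (NumberField.RingOfIntegers E')) (hv : ((ℓ : ℕ) : NumberField.RingOfIntegers E') ∈ v.asIdeal), (Literature.NumberTheory.PAdicHodge.fontainePstAdicCompletion v ℓ hv).IsDeRhamFramed (ρ₁.toLocal v)) ∧ (∀ (L : Type) [Field L] [NumberField L] [Algebra E' L], (ρ₁.restrictField L).toGaloisRep.IsIrreducible)) ∧ (ρ₂.toGaloisRep.IsIrreducible ∧ ((∀ᶠ v : IsDedekindDomain.HeightOneSpectrum (NumberField.RingOfIntegers E') in Filter.cofinite, ρ₂.IsUnramifiedAt v) ∧ ∀ (v : IsDedekindDomain.HeightOneSpectrum (NumberField.RingOfIntegers E')) (hv : ((ℓ : ℕ) : NumberField.RingOfIntegers E') ∈ v.asIdeal), (Literature.NumberTheory.PAdicHodge.fontainePstAdicCompletion v ℓ hv).IsDeRhamFramed (ρ₂.toLocal v)) ∧ (∀ (L : Type) [Field L] [NumberField L] [Algebra E' L], (ρ₂.restrictField L).toGaloisRep.IsIrreducible)) ∧ ∀ g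 : Field.absoluteGaloisGroup E', Literature.NumberTheory.GaloisRepresentations.FramedRep.charpoly ((ρ.restrictField E).restrictField E') g = (Matrix.kroneckerMap (· * ·) ((ρ₁ g : GL (Fin a) (PadicAlgCl ℓ)) : Matrix (Fin a) (Fin a) (PadicAlgCl ℓ)) ((ρ₂ g : GL (Fin b) (PadicAlgCl ℓ)) : Matrix (Fin b) (Fin b) (PadicAlgCl ℓ))).charpoly))) ∧ (n = 6 ∧ ∃ (σ : Literature.NumberTheory.GaloisRepresentations.FramedGaloisRep E (PadicAlgCl ℓ) 4) (χ : Literature.NumberTheory.GaloisRepresentations.FramedGaloisRep E (PadicAlgCl ℓ) 1), (σ.toGaloisRep.IsIrreducible ∧ ((∀ᶠ v : IsDedekindDomain.HeightOneSpectrum (NumberField.RingOfIntegers E) in Filter.cofinite, σ.IsUnramifiedAt v) ∧ ∀ (v : IsDedekindDomain.HeightOneSpectrum (NumberField.RingOfIntegers E)) (hv : ((ℓ : ℕ) : NumberField.RingOfIntegers E) ∈ v.asIdeal), (Literature.NumberTheory.PAdicHodge.fontainePstAdicCompletion v ℓ hv).IsDeRhamFramed (σ.toLocal v)) ∧ (∀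 (L : Type) [Field L] [NumberField L] [Algebra E L], (σ.restrictField L).toGaloisRep.IsIrreducible)) ∧ ((∀ᶠ v : IsDedekindDomain.HeightOneSpectrum (NumberField.RingOfIntegers E) in Filter.cofinite, χ.IsUnramifiedAt v) ∧ ∀ (v : IsDedekindDomain.HeightOneSpectrum (NumberField.RingOfIntegers E)) (hv : ((ℓ : ℕ) : NumberField.RingOfIntegers E) ∈ v.asIdeal), (Literature.NumberTheory.PAdicHodge.fontainePstAdicCompletion v ℓ hv).IsDeRhamFramed (χ.toLocal v)) ∧ ∀ g : Field.absoluteGaloisGroup E, (Literature.NumberTheory.GaloisRepresentations.FramedRep.charpoly (ρ.restrictField E) g).roots = (((Literature.NumberTheory.GaloisRepresentations.FramedRep.charpoly σ g).roots.powersetCard 2).map Multiset.prod).map (fun x => Literature.NumberTheory.GaloisRepresentations.FramedRep.trace χ g * x)))) → ∃ π : Literature.NumberTheory.Automorphic.CuspidalAutomorphicRepData n K hcpt, π.1.IsLAlgebraic ∧ ∀ᶠ v : IsDedekindDomain.HeightOneSpectrum (NumberField.RingOfIntegers K) in Filter.cofinite, SatakeFrobCompatibleAt ι π.1 ρ v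

/-- FRAME · support · the HOST ROUTE below PRIM, as one implication BY NAME.  Certified from the host's `KroneckerPrimitivitySplit.closes`
and the host items (`frame_of_host`); trivially from Langlands. -/
def TensorPrimitiveFrame : Prop :=
  Summit.Langlands.Langlands.Theses.KroneckerPrimitivitySplit.SolvablyTensorPrimitiveAutomorphy → _root_.Langlands

/-! ## 5. Identity of the items with the structured forms (`Iff.rfl` ×3) and of the dedup binders with the host (`Iff.rfl` ×2) -/

/-- The filed item text of ACC is the structured cell, definitionally. -/
theorem accidentalWindowTransport_iff : AccidentalWindowTransport ↔
    ∀ (K : Type) [Field K] [NumberField K] (n : ℕ) (hcpt : Literature.NumberTheory.Automorphic.isCompact_glFiniteIntegralLevel n K), 3 ≤ n → RankIH n →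
      ∀ (ℓ : ℕ) [Fact ℓ.Prime] (ι : PadicAlgCl ℓ ≃+* ℂ) (ρ : Literature.NumberTheory.GaloisRepresentations.FramedGaloisRep K (PadicAlgCl ℓ) n), ρ.toGaloisRep.IsIrreducible → PinnedGeometric ρ →
        IsLieIrreducible ρ → ¬ HasProgressionSpectra ρ → ¬ IsSolvablyKronecker ρ → IsRationalExteriorSquare ρ → WeakAutomorphic hcpt ι ρ := Iff.rfl

/-- The filed item text of SMALL is the structured cell, definitionally. -/
theorem smallTypeTransport_iff : SmallTypeTransport ↔
    ∀ (K : Type) [Field K] [NumberField K] (n : ℕ) (hcpt : Literature.NumberTheory.Automorphic.isCompact_glFiniteIntegralLevel n K), 3 ≤ n → RankIH n →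
      ∀ (ℓ : ℕ) [Fact ℓ.Prime] (ι : PadicAlgCl ℓ ≃+* ℂ) (ρ : Literature.NumberTheory.GaloisRepresentations.FramedGaloisRep K (PadicAlgCl ℓ) n), ρ.toGaloisRep.IsIrreducible → PinnedGeometric ρ →
        IsLieIrreducible ρ → ¬ HasProgressionSpectra ρ → ¬ IsSolvablyKronecker ρ → ¬ HasRatioRankAtLeast ρ (n / 2) → WeakAutomorphic hcpt ι ρ := Iff.rfl

/-- The filed item text of STD is the structured cell, definitionally. -/
theorem standardTypeAutomorphy_iff : StandardTypeAutomorphy ↔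
    ∀ (K : Type) [Field K] [NumberField K] (n : ℕ) (hcpt : Literature.NumberTheory.Automorphic.isCompact_glFiniteIntegralLevel n K), 3 ≤ n → RankIH n →
      ∀ (ℓ : ℕ) [Fact ℓ.Prime] (ι : PadicAlgCl ℓ ≃+* ℂ) (ρ : Literature.NumberTheory.GaloisRepresentations.FramedGaloisRep K (PadicAlgCl ℓ) n), ρ.toGaloisRep.IsIrreducible → PinnedGeometric ρ →
        IsLieIrreducible ρ → ¬ HasProgressionSpectra ρ → ¬ IsSolvablyKronecker ρ → (HasRatioRankAtLeast ρ (n / 2) ∧ ¬ IsSolvablyExteriorSquare ρ) →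
          WeakAutomorphic hcpt ι ρ := Iff.rfl

/-- the host's W⁺ decl is the grand-host's item stmt-Langlands-17415, definitionally. -/
theorem wplus_iff_host : KroneckerPrimitivitySplit.SatakeAvatarExistence ↔ MonodromyDichotomy.SatakeAvatarExistence := Iff.rfl

/-- the host's CSD decl is the twin's (hence `HolomorphicLimitSplit.CliffordSolvableDescent`, stmt-Langlands-31695), definitionally. -/
theorem csd_iff_twin : KroneckerPrimitivitySplit.CliffordSolvableDescent ↔ Summit.Langlands.Langlands.Theorems.MonodromyDichotomyKroneckerPrimitivity.CliffordSolvableDescent := Iff.rfl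

/-! ## 6. Kernels -/

/-- PRIM ⟹ each cell (every cell is PRIM with ONE extra hypothesis): OUTRIGHT. -/
theorem cells_of_prim (hP : KroneckerPrimitivitySplit.SolvablyTensorPrimitiveAutomorphy) :
    AccidentalWindowTransport ∧ SmallTypeTransport ∧ StandardTypeAutomorphy :=
  ⟨fun K _ _ n hcpt h3 hIH ℓ _ ι ρ hirr hgeo hLie hPS hSK _ => hP K n hcpt h3 hIH ℓ ι ρ hirr hgeo hLie hPS hSK,
   fun K _ _ n hcpt h3 hIH ℓ _ ι ρ hirr hgeo hLie hPS hSK _ => hP K n hcpt h3 hIH ℓ ι ρ hirr hgeo hLie hPS hSK,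
   fun K _ _ n hcpt h3 hIH ℓ _ ι ρ hirr hgeo hLie hPS hSK _ => hP K n hcpt h3 hIH ℓ ι ρ hirr hgeo hLie hPS hSK⟩

/-- **the cells ⟹ PRIM modulo (W⁺ ∧ CSD)**: excluded middle on the SOLVABLE exterior-square dial; on the window run ACC over E on ρ|_E (the
rank-IH is field-universal and passes through; the PRIM-box of ρ|_E is part of the dial) and descend the weak automorphy E → K by CSD fed with
W⁺ (ϑ := ρ|_E, rank-0 complement); off the window, excluded middle on the Cartan rank over K: STD or SMALL verbatim.  (= `childroute.glue.lean`.) -/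
theorem prim_of_cells (hW : KroneckerPrimitivitySplit.SatakeAvatarExistence) (hCSD : KroneckerPrimitivitySplit.CliffordSolvableDescent)
    (hacc : AccidentalWindowTransport) (hsmall : SmallTypeTransport) (hstd : StandardTypeAutomorphy) :
    KroneckerPrimitivitySplit.SolvablyTensorPrimitiveAutomorphy := by
  intro K _ _ n hcpt h3 hIH ℓ _ ι ρ hirr hgeo hLie hPS hSK
  by_cases hd : IsSolvablyExteriorSquare ρ
  · obtain ⟨E, _, _, _, hGal, hSolv, ⟨⟨hirrE, hgeoE, hLieE, hPSE⟩, hSKE⟩, hX⟩ := hd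
    have hn : 0 < n := by omega
    have autE : ∀ hcptE : Literature.NumberTheory.Automorphic.isCompact_glFiniteIntegralLevel n E, WeakAutomorphic hcptE ι (ρ.restrictField E) := fun hcptE =>
      hacc E n hcptE h3 hIH ℓ ι (ρ.restrictField E) hirrE hgeoE hLieE hPSE hSKE hX
    exact hCSD hW K n ℓ ι ρ hirr hgeo hn E hGal hSolv n (ρ.restrictField E) hirrE (trace_restrictField_eq_add_zero ρ E) hn autE hcpt
  · by_cases hr : HasRatioRankAtLeast ρ (n / 2)
    · exact hstd K n hcpt h3 hIH ℓ ι ρ hirr hgeo hLie hPS hSK ⟨hr, hd⟩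
    · exact hsmall K n hcpt h3 hIH ℓ ι ρ hirr hgeo hLie hPS hSK hr

/-- **EXACTNESS**: modulo (W⁺ ∧ CSD), PRIM ⟺ ACC ∧ SMALL ∧ STD (and ⟹ holds outright, `cells_of_prim`). -/
theorem prim_iff_cells (hW : KroneckerPrimitivitySplit.SatakeAvatarExistence) (hCSD : KroneckerPrimitivitySplit.CliffordSolvableDescent) :
    KroneckerPrimitivitySplit.SolvablyTensorPrimitiveAutomorphy ↔ AccidentalWindowTransport ∧ SmallTypeTransport ∧ StandardTypeAutomorphy :=
  ⟨cells_of_prim, fun h => prim_of_cells hW hCSD h.1 h.2.1 h.2.2⟩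

/-- **THE FRAME IS THE HOST ROUTE**: the host items KT_low, KT_high, CSD, W⁺, FRAME_H (BY NAME) ⟹ (PRIM → Langlands), through the host's
certified `KroneckerPrimitivitySplit.closes`. -/
theorem frame_of_host (hlow : KroneckerPrimitivitySplit.LowRankKroneckerTransport) (hhigh : KroneckerPrimitivitySplit.HigherKroneckerTransport)
    (hCSD : KroneckerPrimitivitySplit.CliffordSolvableDescent) (hW : KroneckerPrimitivitySplit.SatakeAvatarExistence) (hFH : KroneckerPrimitivitySplit.HigherLieRankFrame) :
    TensorPrimitiveFrame := fun hprim =>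
  KroneckerPrimitivitySplit.closes hlow hhigh hprim hCSD hW hFH

/-- … and FRAME_H is the GRAND-HOST route MonodromyDichotomy rev 3 (its items BY NAME, through the landed resplit glue and
`MonodromyDichotomy.closes` — the twin's `frame_of_host`): the whole frame spelled down to the grand-host's open items. -/
theorem frame_of_grandhost (h1 : MonodromyDichotomy.RankOneAutomorphy) (hSP : MonodromyDichotomy.SpecialCellAutomorphy)
    (hGE : MonodromyDichotomy.GenericModuliAutomorphy) (hSYM : MonodromyDichotomy.SymmetricPowerTransport)
    (hS : MonodromyDichotomy.ArtinTypeAutomorphy) (hT : MonodromyDichotomy.CliffordTateStructure) (hX : MonodromyDichotomy.StructuredTransport)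
    (hW : MonodromyDichotomy.SatakeAvatarExistence) (hP : MonodromyDichotomy.PadicMemberCompatibility)
    (hA : MonodromyDichotomy.CompatibilityAwayFromLR) (hR : MonodromyDichotomy.CanonicalReciprocityData)
    (hlow : KroneckerPrimitivitySplit.LowRankKroneckerTransport) (hhigh : KroneckerPrimitivitySplit.HigherKroneckerTransport) (hCSD : KroneckerPrimitivitySplit.CliffordSolvableDescent) :
    TensorPrimitiveFrame :=
  frame_of_host hlow hhigh hCSD hW (Summit.Langlands.Langlands.Theorems.MonodromyDichotomyKroneckerPrimitivity.frame_of_host h1 hSP hGE hSYM hS hT hX hW hP hA hR)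

/-- the frame is (trivially) implied by the summit. -/
theorem frame_of_langlands (h : _root_.Langlands) : TensorPrimitiveFrame := fun _ => h

/-- NECESSITY: PRIM is implied by the summit (clause (B) at a reciprocity datum, conjunct 1 of `Corresponds`). -/
theorem prim_of_langlands (h : _root_.Langlands) : KroneckerPrimitivitySplit.SolvablyTensorPrimitiveAutomorphy := by
  intro K _ _ n hcpt h3 _ ℓ _ ι ρ hirr hgeo _ _ _
  obtain ⟨⟨𝓡⟩, h𝓡⟩ := h K
  obtain ⟨π, hL, hcorr⟩ := (h𝓡 𝓡 n (by omega) hcpt).2 ℓ ι ρ hirr hgeo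
  exact ⟨π, hL, hcorr.1⟩

/-- … hence so is every NEW cell (no strengthening anywhere). -/
theorem accidentalWindowTransport_of_langlands (h : _root_.Langlands) : AccidentalWindowTransport :=
  (cells_of_prim (prim_of_langlands h)).1
/-- S ⟹ SMALL (necessity: the cell is weaker than the summit). -/
theorem smallTypeTransport_of_langlands (h : _root_.Langlands) : SmallTypeTransport :=
  (cells_of_prim (prim_of_langlands h)).2.1
/-- S ⟹ STD (necessity: the cell is weaker than the summit). -/
theorem standardTypeAutomorphy_of_langlands (h : _root_.Langlands) : StandardTypeAutomorphy :=
  (cells_of_prim (prim_of_langlands h)).2.2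

/-- W⁺ is implied by the summit (clause (A): an IRREDUCIBLE avatar with a.e. Satake compatibility). -/
theorem wplus_of_langlands (h : _root_.Langlands) : KroneckerPrimitivitySplit.SatakeAvatarExistence := by
  intro K _ _ n hcpt hn π hπ ℓ _ ι
  obtain ⟨⟨𝓡⟩, h𝓡⟩ := h K
  obtain ⟨ρ, hirr, _, hcorr, _⟩ := (h𝓡 𝓡 n hn hcpt).1 π hπ ℓ ι
  exact ⟨ρ, hirr, hcorr.1⟩

/-- CSD is implied by the summit (its conclusion is clause (B) for ρ over K; the descent hypotheses are not needed). -/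
theorem csd_of_langlands (h : _root_.Langlands) : KroneckerPrimitivitySplit.CliffordSolvableDescent := by
  intro _ K _ _ n ℓ _ ι ρ hirr hgeo hn E _ _ _ _ _ m ϑ _ _ _ _ hcpt
  obtain ⟨⟨𝓡⟩, h𝓡⟩ := h K
  obtain ⟨π, hL, hcorr⟩ := (h𝓡 𝓡 n hn hcpt).2 ℓ ι ρ hirr hgeo
  exact ⟨π, hL, hcorr.1⟩

/-- **DECIDING THEOREM of the child route** (= `childroute.glue.lean` VERBATIM up to the frame application): the three cells, CSD, W⁺ and the
frame ⟹ `_root_.Langlands` BY NAME. -/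
theorem closes (hacc : AccidentalWindowTransport) (hsmall : SmallTypeTransport) (hstd : StandardTypeAutomorphy)
    (hCSD : KroneckerPrimitivitySplit.CliffordSolvableDescent) (hW : KroneckerPrimitivitySplit.SatakeAvatarExistence) (hF : TensorPrimitiveFrame) : _root_.Langlands :=
  hF (prim_of_cells hW hCSD hacc hsmall hstd)

/-- the deciding theorem with the HOST ITEMS in place of the frame (what the child route decides, spelled over the host route's open items). -/
theorem closes_host_shape (hlow : KroneckerPrimitivitySplit.LowRankKroneckerTransport) (hhigh : KroneckerPrimitivitySplit.HigherKroneckerTransport)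
    (hCSD : KroneckerPrimitivitySplit.CliffordSolvableDescent) (hW : KroneckerPrimitivitySplit.SatakeAvatarExistence) (hFH : KroneckerPrimitivitySplit.HigherLieRankFrame)
    (hacc : AccidentalWindowTransport) (hsmall : SmallTypeTransport) (hstd : StandardTypeAutomorphy) : _root_.Langlands :=
  closes hacc hsmall hstd hCSD hW (frame_of_host hlow hhigh hCSD hW hFH)

/-- **EXACTNESS of the child route, mod NOTHING**: Langlands ⟺ (ACC ∧ SMALL ∧ STD) ∧ CSD ∧ W⁺ ∧ FRAME. -/
theorem langlands_iff_pieces : _root_.Langlands ↔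
    (AccidentalWindowTransport ∧ SmallTypeTransport ∧ StandardTypeAutomorphy) ∧ KroneckerPrimitivitySplit.CliffordSolvableDescent ∧
      KroneckerPrimitivitySplit.SatakeAvatarExistence ∧ TensorPrimitiveFrame :=
  ⟨fun h => ⟨cells_of_prim (prim_of_langlands h), csd_of_langlands h, wplus_of_langlands h, frame_of_langlands h⟩,
   fun h => closes h.1.1 h.1.2.1 h.1.2.2 h.2.1 h.2.2.1 h.2.2.2⟩

/-- the rank-IH every cell carries is itself implied by the summit (no cell is vacuously true under Langlands by a false antecedent). -/
theorem rankIH_of_langlands' (h : _root_.Langlands) (n : ℕ) : RankIH n :=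
  Summit.Langlands.Langlands.Theorems.MonodromyDichotomyKroneckerPrimitivity.rankIH_of_langlands h n

/-! ## 7. Consistency of the two dials with the host dials (documentation lemmas, kernel-checked shape facts) -/

/-- the solvable window dial CONTAINS the PRIM-box of the restriction (so ACC, a PRIM-shaped cell, applies over the witness field with no
heredity lemma). -/
theorem inTensorPrimitiveBox_of_isSolvablyExteriorSquare {K : Type} [Field K] [NumberField K] {ℓ : ℕ} [Fact ℓ.Prime] {n : ℕ}
    (ρ : Literature.NumberTheory.GaloisRepresentations.FramedGaloisRep K (PadicAlgCl ℓ) n) (h : IsSolvablyExteriorSquare ρ) :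
    ∃ (E : Type) (_ : Field E) (_ : NumberField E) (_ : Algebra K E), IsGalois K E ∧ IsSolvable (E ≃ₐ[K] E) ∧
      InTensorPrimitiveBox (ρ.restrictField E) := by
  obtain ⟨E, _, _, _, hG, hS, hB, _⟩ := h
  exact ⟨E, inferInstance, inferInstance, inferInstance, hG, hS, hB⟩

/-- the K-rational window forces rank 6. -/
theorem rank_of_isRationalExteriorSquare {K : Type} [Field K] [NumberField K] {ℓ : ℕ} [Fact ℓ.Prime] {n : ℕ}
    (ρ : Literature.NumberTheory.GaloisRepresentations.FramedGaloisRep K (PadicAlgCl ℓ) n) (h : IsRationalExteriorSquare ρ) : n = 6 := h.1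

end Summit.Langlands.Langlands.Theorems.MonodromyDichotomyCartanRank
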